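import Summits.HodgeConjecture.CorCM.MumfordTateRankTypeIVThreefoldPairsCells
import Summits.HodgeConjecture.CorCM.MumfordTateRankRigidTimesNonCMCurve
import Summits.HodgeConjecture.CorCM.HodgeLieAlgebraReductive
import Literature.AlgebraicGeometry.HodgeTheory.RankOneCentreTimesCMCurveInvariance
import Literature.Algebra.Lie.SemisimpleDimensionEight
import HarnessLib

/-!
# Per-factor data of a simple type-IV(2,1) abelian threefold for the unitary Lemma (3.4)
# (derived Hodge Lie algebra simple of dimension `8`; skew centre `ℚφ^*`; multiplicities; the `Θ`-trace `tr(Θ_T φ^*_ℂ) = ±2i√d`)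

COR-CM (cell `pub-hodgecm2`, seat `b27` gen 52, count-neutral Mumford–Tate-rank ladder; theorems only, no definition, no named fact; UNCONDITIONAL —
nothing here uses or asserts HC_CM).  For a SIMPLE complex abelian threefold `T` with `dim_ℚ End⁰T = 2` (so `End⁰T = ℚ(φ)`, `φ² = −d`, an
imaginary quadratic field acting on `H^{1,0}` with multiplicities `{2, 1}`; `t(T) = 10`, `Lie Hg(H¹T)` a `ℚ`-form of `𝔲(2,1)`):
* §1 **`derived_facts_of_isSimple_threefold`** — `𝔡 = [Lie Hg(H¹T), Lie Hg(H¹T)]` is SIMPLE (every `𝔡`-stable subspace is `0` or `𝔡`),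
  CENTRE-FREE and `8`-dimensional: `Lie Hg = ℚφ^* ⊕ 𝔡` (Deligne, `CorCM/HodgeLieAlgebraReductive`), `dim Lie Hg = 9`, and a semisimple
  `8`-dimensional Lie algebra over a field of characteristic `0` is simple (`Algebra/Lie/SemisimpleDimensionEight`).
* §2 **`typeIV_threefold_factor_data`** — the data of `H¹T` consumed by `CorCM/MumfordTateRankUnitaryPair{Splitting,Centre,Count}`: an endomorphism
  `φ` with `φ ≫ φ = −d` (`d > 0`), `φ^* ∈ End_Hdg`, `(φ^*)² = −d`, `End_Hdg = ℚ + ℚφ^*` (Riemann), an eigenvalue `μ` (`μ² = −d`) of multiplicity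
  `1` on `H^{0,1}` and `≥ 2` on `H^{1,0}`, `φ^* ∈ Lie Hg` (`Θ`-rigidity), the `ψ`-skew centre of `Lie Hg` inside `ℚφ^*`, and the `Θ`-trace
  `tr(Θ_T ∘ φ^*_ℂ) = i√d · k` with `k = 2(n_{i√d} − n_{−i√d}) ≠ 0` (`n_{i√d} + n_{−i√d} = 3` is odd; `HodgeTheory/RankOneCentreTimesCMCurveInvariance`).

## References
* [MoonenZarhin1999LowDim] B. Moonen, Yu. G. Zarhin, *Hodge classes on abelian varieties of low dimension*, Math. Ann. 315 (1999), §2 (2.3), §3 (3.1)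
  [corpus: paper:arxiv-math_9901113 pp. 5–6]. [cite: MoonenZarhin1999LowDim, §2 (2.3)]
* [Ribet1983] K. A. Ribet, *Hodge classes on certain types of abelian varieties*, Amer. J. Math. 105 (1983), Thm. 3. [cite: Ribet1983, Thm. 3]
* [Deligne1982HodgeCycles] P. Deligne, LNM 900 (1982), I §3 Prop. 3.4, Prop. 3.6. [cite: Deligne1982HodgeCycles, I §3 Prop. 3.6]
* [Gordon1997] B. B. Gordon, 1.13.2 (`tr(Θφ) = 2i√d(n′ − n″)`). [cite: Gordon1997, 1.13.2]
-/

noncomputable section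

open scoped TensorProduct
open CategoryTheory CategoryTheory.Limits Module NumberField

namespace Summit.HodgeConjecture.CorCM

open Literature.AlgebraicGeometry.Motives
open Literature.AlgebraicGeometry.Motives.AbelianVariety
open Literature.AlgebraicGeometry.Motives.HodgeStructure
open Literature.AlgebraicGeometry.HodgeTheory
open Literature.AlgebraicGeometry.ComplexMultiplication
open Literature.AlgebraicGeometry.Milne1999 (hom_eq_zero_of_isSimple_of_not_isIsogenous)

variable [HodgeTensorFacts.{0, 0}] {X : AbelianVariety ℂ} {n : ℕ}

/-! ## §1 The derived Hodge Lie algebra of a simple type-IV(2,1) threefold is simple of dimension `8` -/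

set_option maxHeartbeats 800000 in
/-- **`𝔡 = [Lie Hg(H¹T), Lie Hg(H¹T)]` is SIMPLE, CENTRE-FREE and `8`-dimensional** for a simple abelian threefold `T` with `dim_ℚ End⁰T = 2`:
`Lie Hg = ℚφ^* ⊕ 𝔡` (Deligne, `CorCM/HodgeLieAlgebraReductive`; the skew centre is `ℚφ^*`), `dim Lie Hg = 9`, `𝔡` semisimple of dimension `8`,
hence simple (`SemisimpleDimensionEight`); stated on subspaces: every `𝔡`-stable subspace of `𝔡` is `0` or `𝔡`, and the centre of `𝔡` is `0`.
[cite: Deligne1982HodgeCycles, I §3 Prop. 3.6] [cite: MoonenZarhin1999LowDim, §2 (2.3)] -/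
theorem derived_facts_of_isSimple_threefold {T : AbelianVariety ℂ} (hT : IsSmoothProjective n T.X) (hTs : T.IsSimple) (hT3 : T.dim = 3)
    (hTE : Module.finrank ℚ T.endAlgebra = 2) :
    haveI := BettiUniverse.finite hT 1
    (∀ 𝔡 I : Submodule ℚ (Module.End ℚ (bettiCohomology T.X 1)),
        𝔡 = Submodule.span ℚ {B | ∃ X' ∈ (BettiUniverse.hodge exists_isReal_hodgeModel_holds hT 1).hodgeLie,
          ∃ Y ∈ (BettiUniverse.hodge exists_isReal_hodgeModel_holds hT 1).hodgeLie, X' * Y - Y * X' = B} →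
        I ≤ 𝔡 → (∀ X' ∈ 𝔡, ∀ Y ∈ I, X' * Y - Y * X' ∈ I) → I = ⊥ ∨ I = 𝔡) ∧
      (∀ 𝔡 : Submodule ℚ (Module.End ℚ (bettiCohomology T.X 1)),
        𝔡 = Submodule.span ℚ {B | ∃ X' ∈ (BettiUniverse.hodge exists_isReal_hodgeModel_holds hT 1).hodgeLie,
          ∃ Y ∈ (BettiUniverse.hodge exists_isReal_hodgeModel_holds hT 1).hodgeLie, X' * Y - Y * X' = B} →
        ∀ d ∈ 𝔡, (∀ X' ∈ 𝔡, X' * d = d * X') → d = 0) ∧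
      Module.finrank ℚ ↥(Submodule.span ℚ {B | ∃ X' ∈ (BettiUniverse.hodge exists_isReal_hodgeModel_holds hT 1).hodgeLie,
          ∃ Y ∈ (BettiUniverse.hodge exists_isReal_hodgeModel_holds hT 1).hodgeLie, X' * Y - Y * X' = B}) = 8 := by
  classical
  have hnT : T.dim = n := schemeDim_eq_holds hT
  subst hnT
  haveI := BettiUniverse.finite hT 1
  letI : LieRing (Module.End ℚ (bettiCohomology T.X 1)) := LieRing.ofAssociativeRing
  letI : LieAlgebra ℚ (Module.End ℚ (bettiCohomology T.X 1)) := LieAlgebra.ofAssociativeAlgebra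
  set H := BettiUniverse.hodge exists_isReal_hodgeModel_holds hT 1 with hHdef
  set 𝔡₀ : Submodule ℚ (Module.End ℚ (bettiCohomology T.X 1)) :=
    Submodule.span ℚ {B | ∃ X' ∈ H.hodgeLie, ∃ Y ∈ H.hodgeLie, X' * Y - Y * X' = B} with h𝔡₀
  have h𝔡𝔥 : 𝔡₀ ≤ H.hodgeLie := Submodule.span_le.2 (by rintro _ ⟨X', hX, Y, hY, rfl⟩; exact H.commutator_mem_hodgeLie hX hY)
  -- the Lie subalgebra with carrier `𝔡₀`, semisimple (Deligne)
  let 𝔏 : LieSubalgebra ℚ (Module.End ℚ (bettiCohomology T.X 1)) :=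
    { 𝔡₀ with
      lie_mem' := fun {X' Y} hX hY => by rw [Ring.lie_def]; exact Submodule.subset_span ⟨X', h𝔡𝔥 hX, Y, h𝔡𝔥 hY, rfl⟩ }
  have h𝔏 : 𝔏.toSubmodule = 𝔡₀ := rfl
  obtain ⟨hss, htr⟩ := isSemisimple_of_eq_hodgeLie_hodge_one_derived hT 𝔏 h𝔏
  -- dimension count: `9 = dim Lie Hg = dim centre + dim 𝔡₀`, centre `= ℚφ^*`
  have h0 : 0 < T.dim := by omega
  obtain ⟨ψ⟩ := BettiUniverse.hodge_isPolarizable exists_isReal_hodgeModel_holds hT 1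
  have hF : IsField T.endAlgebra := AbelianVariety.isField_endAlgebra_of_isSimple_of_finrank_eq_two hTs h0 hTE
  have hnR : ¬ IsTotallyReal (EndField T hF) := fun hR => by
    have h := finrank_endAlgebra_dvd_dim_of_isField_of_isTotallyReal hF h0 hR
    rw [hTE, hT3] at h; omega
  obtain ⟨a, q, hq, ha⟩ := AbelianVariety.exists_mul_self_eq_neg_of_finrank_eq_two h0 hTE hF hnR
  obtain ⟨φ, d, hd, hφ⟩ := AbelianVariety.exists_hom_comp_self_eq_neg T hq ha
  obtain ⟨hφE, hφ2, hZ⟩ := quadraticEnd_skewCentre_data exists_isReal_hodgeModel_holds hodgePQ_independent_of_hodgeModel_holds h0 hTE hd hφ ψ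
  have hφ𝔥 := bettiMap_mem_hodgeLie_of_isSimple_threefold hT hTs hT3 hTE φ hd hφ
  set φQ : Module.End ℚ (bettiCohomology T.X 1) := (bettiCohomology.map φ.hom.hom.hom 1).hom with hφQ
  haveI : Nontrivial (bettiCohomology T.X 1) := Module.nontrivial_of_finrank_pos (R := ℚ) (by rw [finrank_bettiCohomology_one T]; omega)
  have hφ0 : φQ ≠ 0 := fun h => by
    have h' := hφ2
    rw [h, mul_zero, eq_comm, neg_eq_zero, smul_eq_zero] at h'
    rcases h' with h' | h'
    · exact hd.ne' (by exact_mod_cast h')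
    · exact one_ne_zero h'
  have hcen : H.hodgeLie ⊓ Subalgebra.toSubmodule H.endAlg = ℚ ∙ φQ := by
    apply le_antisymm
    · intro z hz
      obtain ⟨hz𝔥, hzE⟩ := Submodule.mem_inf.1 hz
      obtain ⟨c, rfl⟩ := hZ z hzE (fun b hb => commute_of_mem_hodgeLie H hz𝔥 ⟨b, hb⟩) (form_apply_add_eq_zero_of_mem_hodgeLie ψ hz𝔥)
      exact Submodule.mem_span_singleton.2 ⟨c, rfl⟩
    · rw [Submodule.span_singleton_le_iff_mem]
      exact Submodule.mem_inf.2 ⟨hφ𝔥, hφE⟩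
  have h9 := (mtRank_hodge_one_of_isSimple_threefold_of_finrank_endAlgebra_eq_two hT hTs hT3 hTE).2
  have hdec := finrank_hodgeLie_hodge_one_eq_center_add_derived hT
  rw [h9, hcen, finrank_span_singleton hφ0] at hdec
  have h8 : Module.finrank ℚ 𝔡₀ = 8 := by
    have e : Module.finrank ℚ ↥𝔡₀ = Module.finrank ℚ ↥(Submodule.span ℚ {B | ∃ X' ∈ (BettiUniverse.hodge exists_isReal_hodgeModel_holds hT 1).hodgeLie,
        ∃ Y ∈ (BettiUniverse.hodge exists_isReal_hodgeModel_holds hT 1).hodgeLie, X' * Y - Y * X' = B}) := rfl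
    omega
  haveI : LieAlgebra.IsSimple ℚ 𝔏 := Literature.Algebra.Lie.SemisimpleSmallDimension.isSimple_of_finrank_eq_eight (K := ℚ) h8
  refine ⟨fun 𝔡 I h𝔡 hI hstab => ?_, fun 𝔡 h𝔡 d' hd' hcomm => ?_, h8⟩
  · subst h𝔡
    let J : LieIdeal ℚ 𝔏 :=
      { (I.comap 𝔏.toSubmodule.subtype) with
        lie_mem := fun {x m} hm => by
          change ((⁅x, m⁆ : 𝔏) : Module.End ℚ (bettiCohomology T.X 1)) ∈ I
          rw [LieSubalgebra.coe_bracket, Ring.lie_def]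
          exact hstab _ x.2 _ hm }
    rcases LieAlgebra.IsSimple.eq_bot_or_eq_top J with hJ | hJ
    · left
      refine (Submodule.eq_bot_iff _).2 fun y hy => ?_
      have hy' : (⟨y, hI hy⟩ : 𝔏) ∈ J := hy
      rw [hJ] at hy'
      exact congrArg Subtype.val ((LieSubmodule.mem_bot _).1 hy')
    · right
      refine le_antisymm hI fun d hd => ?_
      have hd' : (⟨d, hd⟩ : 𝔏) ∈ J := by rw [hJ]; exact LieSubmodule.mem_top _
      exact hd'
  · subst h𝔡
    have hmem : (⟨d', hd'⟩ : 𝔏) ∈ LieAlgebra.center ℚ 𝔏 := by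
      rw [LieModule.mem_maxTrivSubmodule]
      intro x
      apply Subtype.ext
      rw [LieSubalgebra.coe_bracket, Ring.lie_def, hcomm _ x.2, sub_self]
      rfl
    have hcz : LieAlgebra.center ℚ 𝔏 = ⊥ := le_bot_iff.1 ((LieAlgebra.center_le_radical ℚ 𝔏).trans (LieAlgebra.radical_eq_bot (R := ℚ) (L := 𝔏)).le)
    rw [hcz, LieSubmodule.mem_bot] at hmem
    exact congrArg Subtype.val hmem

/-! ## §2 Per-factor data -/

/-- **Per-factor data of a simple type-IV(2,1) threefold** in the shape consumed by `UnitaryPair.corners_le_and_finrank_le`,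
`UnitaryPair.incl_phi_proj_mem_hodgeLie_of_nonresonant` and `UnitaryPair.finrank_add_finrank_add_two_le_of_corners` (module docstring §2).
[cite: MoonenZarhin1999LowDim, §2 (2.3)] [cite: Ribet1983, Thm. 3] [cite: Gordon1997, 1.13.2] -/
theorem typeIV_threefold_factor_data {T : AbelianVariety ℂ} (hT : IsSmoothProjective n T.X) (hTs : T.IsSimple) (hT3 : T.dim = 3)
    (hTE : Module.finrank ℚ T.endAlgebra = 2) :
    haveI := BettiUniverse.finite hT 1
    ∃ (φ₀ : T ⟶ T) (d : ℕ) (φ : Module.End ℚ (bettiCohomology T.X 1)) (μ : ℂ) (k : ℤ), 0 < d ∧ φ₀ ≫ φ₀ = -(d • 𝟙 T) ∧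
      φ = (bettiCohomology.map φ₀.hom.hom.hom 1).hom ∧
      φ ∈ (BettiUniverse.hodge exists_isReal_hodgeModel_holds hT 1).endAlg ∧ φ * φ = -((d : ℚ) • 1) ∧
      (∀ a ∈ (BettiUniverse.hodge exists_isReal_hodgeModel_holds hT 1).endAlg, ∃ x y : ℚ, a = x • 1 + y • φ) ∧ μ ^ 2 = -((d : ℚ) : ℂ) ∧
      Module.finrank ℂ ↥(Module.End.eigenspace (φ.baseChange ℂ) μ ⊓ (BettiUniverse.hodge exists_isReal_hodgeModel_holds hT 1).piece 0 1) = 1 ∧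
      2 ≤ Module.finrank ℂ ↥(Module.End.eigenspace (φ.baseChange ℂ) μ ⊓ (BettiUniverse.hodge exists_isReal_hodgeModel_holds hT 1).piece 1 0) ∧
      φ ∈ (BettiUniverse.hodge exists_isReal_hodgeModel_holds hT 1).hodgeLie ∧
      (∀ (ψ : (BettiUniverse.hodge exists_isReal_hodgeModel_holds hT 1).Polarization),
        ∀ z ∈ (BettiUniverse.hodge exists_isReal_hodgeModel_holds hT 1).hodgeLie ⊓
          Subalgebra.toSubmodule (BettiUniverse.hodge exists_isReal_hodgeModel_holds hT 1).endAlg, ∃ c : ℚ, z = c • φ) ∧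
      (Complex.I * (Real.sqrt d : ℂ)) ^ 2 = -((d : ℚ) : ℂ) ∧ k ≠ 0 ∧
      (∀ Θ : Module.End ℂ (ℂ ⊗[ℚ] bettiCohomology T.X 1),
        (∀ p, ∀ x ∈ (BettiUniverse.hodge exists_isReal_hodgeModel_holds hT 1).piece p (((1 : ℕ) : ℤ) - p),
          Θ x = ((2 * p - ((1 : ℕ) : ℤ) : ℤ) : ℂ) • x) →
        LinearMap.trace ℂ _ (Θ * φ.baseChange ℂ) = (Complex.I * (Real.sqrt d : ℂ)) * k) := by
  classical
  have hnT : T.dim = n := schemeDim_eq_holds hT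
  subst hnT
  haveI := BettiUniverse.finite hT 1
  have h0 : 0 < T.dim := by omega
  have hF : IsField T.endAlgebra := AbelianVariety.isField_endAlgebra_of_isSimple_of_finrank_eq_two hTs h0 hTE
  have hnR : ¬ IsTotallyReal (EndField T hF) := fun hR => by
    have h := finrank_endAlgebra_dvd_dim_of_isField_of_isTotallyReal hF h0 hR
    rw [hTE, hT3] at h; omega
  obtain ⟨a, q, hq, ha⟩ := AbelianVariety.exists_mul_self_eq_neg_of_finrank_eq_two h0 hTE hF hnR
  obtain ⟨φ, d, hd, hφ⟩ := AbelianVariety.exists_hom_comp_self_eq_neg T hq ha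
  have hsum := eigenMultiplicity_add_eigenMultiplicity_neg_eq_dim T φ hd hφ
  have hpos := AbelianVariety.eigenMultiplicity_pos_of_isSimple T hTs φ hd hφ (by omega)
  set φQ : Module.End ℚ (bettiCohomology T.X 1) := (bettiCohomology.map φ.hom.hom.hom 1).hom with hφQ
  obtain ⟨ψ₀⟩ := BettiUniverse.hodge_isPolarizable exists_isReal_hodgeModel_holds hT 1
  obtain ⟨hφE, hφ2, -⟩ := quadraticEnd_skewCentre_data exists_isReal_hodgeModel_holds hodgePQ_independent_of_hodgeModel_holds h0 hTE hd hφ ψ₀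
  have hE := exists_eq_smul_one_add_smul_bettiMapHom exists_isReal_hodgeModel_holds hodgePQ_independent_of_hodgeModel_holds hd hφ hTE h0
  have hμ₀ : (Complex.I * (Real.sqrt d : ℂ)) ^ 2 = -((d : ℚ) : ℂ) := by
    rw [mul_pow, Complex.I_sq, ← Complex.ofReal_pow, Real.sq_sqrt (Nat.cast_nonneg d), Complex.ofReal_natCast, Rat.cast_natCast, neg_one_mul]
  have hconj₀ : starRingEnd ℂ (Complex.I * (Real.sqrt d : ℂ)) = -(Complex.I * (Real.sqrt d : ℂ)) := by
    rw [map_mul, Complex.conj_I, Complex.conj_ofReal, neg_mul]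
  obtain ⟨μ, hμ, hm1, hm2⟩ : ∃ μ : ℂ, μ ^ 2 = -((d : ℚ) : ℂ) ∧ eigenMultiplicity T φ (starRingEnd ℂ μ) = 1 ∧ 2 ≤ eigenMultiplicity T φ μ := by
    by_cases h1 : eigenMultiplicity T φ (Complex.I * (Real.sqrt d : ℂ)) = 1
    · exact ⟨-(Complex.I * (Real.sqrt d : ℂ)), by rw [neg_sq, hμ₀], by rw [map_neg, hconj₀, neg_neg, h1], by omega⟩
    · exact ⟨Complex.I * (Real.sqrt d : ℂ), hμ₀, by rw [hconj₀]; omega, by omega⟩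
  refine ⟨φ, d, φQ, μ, 2 * ((eigenMultiplicity T φ (Complex.I * (Real.sqrt d : ℂ)) : ℤ) - eigenMultiplicity T φ (-(Complex.I * (Real.sqrt d : ℂ)))),
    hd, hφ, hφQ, hφE, hφ2, hE, hμ, ?_, ?_, bettiMap_mem_hodgeLie_of_isSimple_threefold hT hTs hT3 hTE φ hd hφ, fun ψ z hz => ?_, hμ₀, by omega,
    fun Θ hΘ => ?_⟩
  · rw [hφQ, finrank_eigenspace_inf_piece_zeroOne_eq_eigenMultiplicity_conj exists_isReal_hodgeModel_holds hodgePQ_independent_of_hodgeModel_holds φ μ, hm1]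
  · rw [hφQ, finrank_eigenspace_inf_piece_oneZero_eq_eigenMultiplicity exists_isReal_hodgeModel_holds hodgePQ_independent_of_hodgeModel_holds φ μ]
    exact hm2
  · obtain ⟨-, -, hZ⟩ := quadraticEnd_skewCentre_data exists_isReal_hodgeModel_holds hodgePQ_independent_of_hodgeModel_holds h0 hTE hd hφ ψ
    obtain ⟨hz𝔥, hzE⟩ := Submodule.mem_inf.1 hz
    exact hZ z hzE (fun b hb => commute_of_mem_hodgeLie _ hz𝔥 ⟨b, hb⟩) (form_apply_add_eq_zero_of_mem_hodgeLie ψ hz𝔥)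
  · rw [hφQ, trace_theta_mul_baseChange_pullback_eq exists_isReal_hodgeModel_holds hodgePQ_independent_of_hodgeModel_holds φ hd hφ hΘ]
    push_cast
    ring

end Summit.HodgeConjecture.CorCM

end
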